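import Literature.AlgebraicGeometry.HodgeTheory.NoTypeIVFactorSubvarietiesQuotients
import Literature.AlgebraicGeometry.HodgeTheory.RealMultiplicationHodgeGroupEqLefschetz
import Literature.AlgebraicGeometry.Motives.AbelianVarietySimpleOfEndAlgebraDomain
import Literature.AlgebraicGeometry.Motives.AbelianVarietyProductIsogeny
import Literature.NumberTheory.NumberFields.TotallyRealOrCM
import HarnessLib

/-!
# «No simple factor of type IV» for abelian varieties with a field of endomorphisms, for abelian
# varieties of CM-type, and in Milne's vocabulary of simple isogeny factors
# (Moonen–Zarhin 1999 §1; Shimura 1998 §5.1–5.2; Milne 1999 §2; Mumford §19)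

Family `hodge`, layer `Literature/AlgebraicGeometry/HodgeTheory`; THEOREMS ONLY — no definition, no named fact, no
`sorry` (D-0026, net debt 0). Lane `lit-hodgefound` (Track 2 foundations library), prover seat `lit-hodgefound-p21`,
generation 29, row g29-#7; sequel of g29-#5 `NoTypeIVFactorSubvarietiesQuotients`
(`hasNoTypeIVFactor_iff_forall_isSimple_hom_ne_zero`, `HasNoTypeIVFactor.image_of_source/target`,
`.of_hom_ne_zero_of_isSimple`) and of the tree's `RealMultiplicationHodgeGroupEqLefschetz`
(`hasNoTypeIVFactor_of_isTotallyReal`: `End⁰(A)` a totally real field ⟹ no factor of type IV).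

PUBLISHED STATEMENTS. Moonen–Zarhin 1999 §1 (held: `paper:arxiv-math_9901113` p0002): Albert's types 1–3 have centre
`F = F₀` totally real, type 4 has centre `F` a CM field (`e = 2e₀`); «a (simple) abelian variety `X` is of Type A if
`End⁰(X)` is an algebra of the corresponding type»; «no factors of Type 4». Shimura 1998 §5.1 Prop. 5 (p. 36): when
`End⁰(A)` is a field it is totally real or a CM field; §5.1 Props. 4, 6 and §5.2 (pp. 36–37): for a simple abelian
variety `B` of CM-type `K = End⁰(B)` is a field of degree `2 dim B`, «`K` must be totally imaginary», hence CM (Milne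
1999 §2 p. 54 «a field (necessarily CM) of degree `2 dim A`») — so every simple abelian variety of CM-type is of type
IV, and the simple isogeny factors of an abelian variety of CM-type (which are of CM-type, Milne 1999 p. 54) are all of
type IV. Mumford §19 Thm. 1, Cor. 1–2 (pp. 173–174): a simple `B ≠ 0` is an isogeny factor of `A` iff
`Hom(B, A) ≠ 0`; `Hom(A, C) = 0` when `A` and `C` have no simple isogeny factor in common. Milne 1986 §12 p. 122:
simple isogeny factors.

MAIN RESULTS (all proved):
* §0 `AbelianVariety.subsingleton_endAlgebra_of_dim_eq_zero`, `AbelianVariety.dim_pos_of_isField_endAlgebra`,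
  `AbelianVariety.exists_isSimple_hom_ne_zero` (`0 < dim A ⟹` some simple `B ≠ 0` has `Hom(B, A) ≠ 0`); Milne's
  `IsSimpleIsogenyFactor B A` made usable: **`Milne1999.isSimpleIsogenyFactor_iff_exists_hom_ne_zero`**
  (`B` simple, `0 < dim B`, `Hom(B, A) ≠ 0`), `IsSimpleIsogenyFactor.exists_hom_ne_zero`,
  `isSimpleIsogenyFactor_of_hom_ne_zero`, `.of_isIsogenous_left/right`, `.dim_pos_right`, `exists_isSimpleIsogenyFactor`.
* §1 `End⁰(A)` a field `E` (tree type `EndField A hF`): **`hasNoTypeIVFactor_iff_isTotallyReal_endField`** (new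
  direction `isTotallyReal_endField_of_hasNoTypeIVFactor`; the converse is the tree's `hasNoTypeIVFactor_of_isTotallyReal`),
  `not_hasNoTypeIVFactor_of_isTotallyComplex_endField`, `not_hasNoTypeIVFactor_of_isCMField_endField`, and — `A` being
  then simple of positive dimension (tree `isSimple_of_isField_endAlgebra`) — **`not_hasNoTypeIVFactor_iff_isCMField_endField`**
  (Shimura §5.1 Prop. 5, tree `isTotallyReal_or_isCMField_endField_of_isSimple`).
* §2 Milne's vocabulary: `HasNoTypeIVFactor.of_isSimpleIsogenyFactor`, `isTotallyReal_centerField_of_isSimpleIsogenyFactor`,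
  **`hasNoTypeIVFactor_iff_forall_isSimpleIsogenyFactor`** (no dimension hypothesis),
  `hasNoTypeIVFactor_iff_forall_isSimpleIsogenyFactor_isTotallyReal_centerField`,
  `not_hasNoTypeIVFactor_iff_exists_isSimpleIsogenyFactor_isCMField_centerField`.
* §3 CM-type: **`not_hasNoTypeIVFactor_of_isSimple_of_isOfCMType`** (a simple abelian variety of CM-type is of type IV),
  `isCMField_centerField_of_isOfCMType`, `hasNoTypeIVFactor_of_dim_eq_zero`, **`not_hasNoTypeIVFactor_of_isOfCMType`**
  (`0 < dim A`), `HasNoTypeIVFactor.not_isOfCMType`, `HasNoTypeIVFactor.dim_eq_zero_of_isOfCMType`,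
  `hasNoTypeIVFactor_and_isOfCMType_iff_dim_eq_zero`, `not_hasNoTypeIVFactor_of_isSimpleIsogenyFactor_of_isOfCMType`.
* §4 orthogonality of the two classes (the pair `(A, C)` of the tree's `hodgeConjectureFor_prod_of_cmHodgeHypothesis`):
  **`hom_eq_zero_of_hasNoTypeIVFactor_of_isOfCMType`** (`Hom(A, C) = 0`), `hom_eq_zero_of_isOfCMType_of_hasNoTypeIVFactor`
  (`Hom(C, A) = 0`), subsingleton forms, `not_isSimpleIsogenyFactor_of_hasNoTypeIVFactor_of_isOfCMType` (no common
  simple isogeny factor).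

## References

* [MoonenZarhin1999LowDim] B. Moonen, Yu. Zarhin, *Hodge classes on abelian varieties of low dimension*, Math. Ann. 315
  (1999), §1 (Albert types; «no factors of Type 4»). [cite: MoonenZarhin1999LowDim, §1]
* [Shimura1998] G. Shimura, *Abelian Varieties with Complex Multiplication and Modular Functions*, §5.1 Props. 4–6
  (p. 36), §5.2 (pp. 36–37). [cite: Shimura1998, §5.1 Proposition 5 (p. 36)]
* [Milne1999] J. S. Milne, *Lefschetz motives and the Tate conjecture*, Compositio Math. 117 (1999), §2 p. 54.
  [cite: Milne1999, §2 p. 54]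
* [Milne1986AbelianVarieties] J. S. Milne, *Abelian Varieties* (Cornell–Silverman 1986), §12 p. 122.
  [cite: Milne1986AbelianVarieties, §12 p. 122]
* [MumfordAV1970] D. Mumford, *Abelian Varieties*, §19 Thm. 1, Cor. 1–2 (pp. 173–174), Remark p. 169; §21 Thm. 2.
  [cite: MumfordAV1970, §19 Thm. 1 and Cor. 1–2 (pp. 173–174)]
* [Deligne1982HodgeCycles] P. Deligne, *Hodge cycles on abelian varieties*, LNM 900, I Prop. 5.1.
  [cite: Deligne1982HodgeCycles, I Prop. 5.1]
-/

noncomputable section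

open CategoryTheory CategoryTheory.Limits NumberField
open _root_.AlgebraicGeometry

universe u

/-! ### §0 Preliminaries: `End⁰` in dimension zero, fields of endomorphisms, simple isogeny factors -/

namespace Literature.AlgebraicGeometry.Motives

namespace AbelianVariety

section DimZero

variable {K : Type u} [Field K] {A : AbelianVariety K}

/-- `End⁰(A) = 0` for `dim A = 0` (`End(A) = 0`, tree `hom_eq_zero_of_dim_eq_zero`; Mumford §19 «The structure of
`End⁰(X)`»: `End⁰(X) = ⊕ M_{nᵢ}(Dᵢ)` over the simple factors, an empty sum for `X = 0`).
[cite: MumfordAV1970, §19 Cor. 2 of Thm. 1 (p. 174) and Thm. 3 (p. 176)] -/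
theorem subsingleton_endAlgebra_of_dim_eq_zero (hA : A.dim = 0) : Subsingleton A.endAlgebra := by
  have h1 : (1 : A.endAlgebra) = 0 := by
    rw [← map_one (endAlgebra.of A), ← map_zero (endAlgebra.of A)]
    congr 1
    exact hom_eq_zero_of_dim_eq_zero (Or.inl hA) _
  exact subsingleton_of_zero_eq_one h1.symm

/-- If `End⁰(A)` is a field then `0 < dim A` (a field is non-trivial, `End⁰(0) = 0`).
[cite: MumfordAV1970, §19 Cor. 2 of Thm. 1 (p. 174) and Thm. 3 (p. 176)] -/
theorem dim_pos_of_isField_endAlgebra (hF : IsField A.endAlgebra) : 0 < A.dim := by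
  by_contra h0
  obtain ⟨x, y, hxy⟩ := hF.exists_pair_ne
  haveI := subsingleton_endAlgebra_of_dim_eq_zero (A := A) (by omega)
  exact hxy (Subsingleton.elim x y)

end DimZero

variable {A B : AbelianVariety ℂ}

/-- **A non-zero complex abelian variety receives a non-zero homomorphism from a simple abelian variety of positive
dimension** (a factor `B_q` of an isotypic decomposition `A ∼ ⨁_q ⨁ B_q`, Mumford §19 Cor. 1, composed with a
quasi-inverse of the isogeny; tree `exists_isIsogenous_biproduct_powers`, g29-#5
`exists_hom_ne_zero_of_isIsogenous_biproduct_powers`). [cite: MumfordAV1970, §19 Thm. 1 and Cor. 1 (pp. 173–174)] -/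
theorem exists_isSimple_hom_ne_zero (hA0 : 0 < A.dim) :
    ∃ B : AbelianVariety ℂ, IsSimple B ∧ 0 < B.dim ∧ ∃ f : B ⟶ A, f ≠ 0 := by
  obtain ⟨Q, _, _, B, m, hS, hd, -, hX⟩ := exists_isIsogenous_biproduct_powers A
  haveI := nonempty_index_of_isIsogenous_biproduct hA0 hX
  obtain ⟨q⟩ := ‹Nonempty Q›
  obtain ⟨f, hf⟩ := exists_hom_ne_zero_of_isIsogenous_biproduct_powers hX q (hd q)
  exact ⟨B q, hS q, hd q, f, hf⟩

end AbelianVariety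

end Literature.AlgebraicGeometry.Motives

namespace Literature.AlgebraicGeometry.Milne1999

open Literature.AlgebraicGeometry.Motives

variable {A A' B B' : AbelianVariety ℂ}

/-- A simple isogeny factor is simple. [cite: Milne1986AbelianVarieties, §12 p. 122] -/
theorem IsSimpleIsogenyFactor.isSimple (h : IsSimpleIsogenyFactor B A) : AbelianVariety.IsSimple B := h.1

/-- A simple isogeny factor has positive dimension. [cite: Milne1986AbelianVarieties, §12 p. 122] -/
theorem IsSimpleIsogenyFactor.dim_pos (h : IsSimpleIsogenyFactor B A) : 0 < B.dim := h.2.1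

/-- If `B` is a simple isogeny factor of `A` then `0 < dim B ≤ dim A` (`dim A = dim B + dim C`).
[cite: Milne1986AbelianVarieties, §12 p. 122] -/
theorem IsSimpleIsogenyFactor.dim_le (h : IsSimpleIsogenyFactor B A) : B.dim ≤ A.dim := by
  obtain ⟨-, -, C, hC⟩ := h
  rw [hC.dim_eq, AbelianVariety.dim_prod]
  exact Nat.le_add_right _ _

/-- … in particular `0 < dim A`. [cite: Milne1986AbelianVarieties, §12 p. 122] -/
theorem IsSimpleIsogenyFactor.dim_pos_right (h : IsSimpleIsogenyFactor B A) : 0 < A.dim :=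
  lt_of_lt_of_le h.dim_pos h.dim_le

/-- **A simple isogeny factor of `A` maps non-trivially to `A`**: from an isogeny `u : A → B × C` with quasi-inverse
`τ` (`u ≫ τ = n`, `τ ≫ u = n`, Mumford §19 Remark p. 169), the composite `B ↪ B × C → A` of `(𝟙, 0)` and `τ` is
non-zero (else `n · (𝟙, 0) = 0`, so `n · 𝟙_B = 0`). [cite: MumfordAV1970, §19 Cor. 1–2 (pp. 173–174) and Remark p. 169]
[cite: Milne1986AbelianVarieties, §12 p. 122] -/
theorem IsSimpleIsogenyFactor.exists_hom_ne_zero (h : IsSimpleIsogenyFactor B A) : ∃ f : B ⟶ A, f ≠ 0 := by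
  obtain ⟨-, hB0, C, u, hu⟩ := h
  obtain ⟨τ, n, hn, -, hτu⟩ := AbelianVariety.IsIsogeny.exists_nsmul_inverse_holds hu
  let ι : B ⟶ B.prod C := AbelianVariety.prodLift (𝟙 B) 0
  have hι : ι ≫ AbelianVariety.fst B C = 𝟙 B := AbelianVariety.prodLift_fst _ _
  refine ⟨ι ≫ τ, fun h0 => ?_⟩
  have h1 : n • ι = 0 := by
    calc n • ι = ι ≫ (τ ≫ u) := by rw [hτu, Preadditive.comp_nsmul, Category.comp_id]
      _ = 0 := by rw [← Category.assoc, h0, zero_comp]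
  have h2 : ι = 0 := AbelianVariety.hom_eq_zero_of_nsmul_eq_zero hn.ne' h1
  exact AbelianVariety.id_ne_zero_of_dim_pos hB0 (by rw [← hι, h2, zero_comp])

/-- **A simple `B ≠ 0` with `Hom(B, A) ≠ 0` is a simple isogeny factor of `A`**: `B ∼ im f ↪ A`
(`isIsogenous_image_of_isSimple`) and an abelian subvariety is an isogeny factor (Poincaré, tree
`isSimpleIsogenyFactor_of_isClosedImmersion`), `A ∼ im f × C ∼ B × C`.
[cite: MumfordAV1970, §19 Thm. 1 and Cor. 1–2 (pp. 173–174)] [cite: Milne1986AbelianVarieties, §12 p. 122 and Prop. 12.1] -/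
theorem isSimpleIsogenyFactor_of_hom_ne_zero (hB : AbelianVariety.IsSimple B) (hB0 : 0 < B.dim) (f : B ⟶ A)
    (hf : f ≠ 0) : IsSimpleIsogenyFactor B A := by
  have hBi : AbelianVariety.IsIsogenous B (AbelianVariety.image f) :=
    AbelianVariety.isIsogenous_image_of_isSimple hB f hf
  obtain ⟨-, -, C, hC⟩ := isSimpleIsogenyFactor_of_isClosedImmersion (AbelianVariety.imageι f)
    (hB.of_isIsogenous hBi) (AbelianVariety.dim_image_pos f hf)
  exact ⟨hB, hB0, C, hC.trans (hBi.symm'.prod (AbelianVariety.IsIsogenous.refl C))⟩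

/-- **Simple isogeny factors through `Hom`**: `B` is a simple isogeny factor of `A` iff `B` is simple of positive
dimension and `Hom(B, A) ≠ 0`. [cite: MumfordAV1970, §19 Thm. 1 and Cor. 1–2 (pp. 173–174)]
[cite: Milne1986AbelianVarieties, §12 p. 122] -/
theorem isSimpleIsogenyFactor_iff_exists_hom_ne_zero :
    IsSimpleIsogenyFactor B A ↔ AbelianVariety.IsSimple B ∧ 0 < B.dim ∧ ∃ f : B ⟶ A, f ≠ 0 :=
  ⟨fun h => ⟨h.1, h.2.1, h.exists_hom_ne_zero⟩,
    fun ⟨hB, hB0, f, hf⟩ => isSimpleIsogenyFactor_of_hom_ne_zero hB hB0 f hf⟩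

/-- Simple isogeny factors depend only on the isogeny class of `A`. [cite: Milne1986AbelianVarieties, §12 p. 122] -/
theorem IsSimpleIsogenyFactor.of_isIsogenous_right (h : IsSimpleIsogenyFactor B A)
    (hA : AbelianVariety.IsIsogenous A A') : IsSimpleIsogenyFactor B A' := by
  obtain ⟨hB, hB0, C, hC⟩ := h
  exact ⟨hB, hB0, C, hA.symm'.trans hC⟩

/-- … and on the isogeny class of `B`. [cite: Milne1986AbelianVarieties, §12 p. 122] -/
theorem IsSimpleIsogenyFactor.of_isIsogenous_left (h : IsSimpleIsogenyFactor B A)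
    (hB' : AbelianVariety.IsIsogenous B B') : IsSimpleIsogenyFactor B' A := by
  obtain ⟨hB, hB0, C, hC⟩ := h
  exact ⟨hB.of_isIsogenous hB', hB'.dim_eq ▸ hB0, C, hC.trans (hB'.prod (AbelianVariety.IsIsogenous.refl C))⟩

/-- **Every non-zero complex abelian variety has a simple isogeny factor.** [cite: MumfordAV1970, §19 Cor. 1 (p. 173)]
[cite: Milne1986AbelianVarieties, §12 p. 122] -/
theorem exists_isSimpleIsogenyFactor (hA0 : 0 < A.dim) : ∃ B : AbelianVariety ℂ, IsSimpleIsogenyFactor B A := by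
  obtain ⟨B, hB, hB0, f, hf⟩ := AbelianVariety.exists_isSimple_hom_ne_zero hA0
  exact ⟨B, isSimpleIsogenyFactor_of_hom_ne_zero hB hB0 f hf⟩

end Literature.AlgebraicGeometry.Milne1999

namespace Literature.AlgebraicGeometry.HodgeTheory

open Literature.AlgebraicGeometry.Motives
open Literature.AlgebraicGeometry.ComplexMultiplication
open Literature.AlgebraicGeometry.Milne1999

variable {A B C : AbelianVariety ℂ}

/-! ### §1 `End⁰(A)` a field: no factor of type IV iff the field is totally real; type IV iff it is CM -/

/-- A totally complex number field is not totally real (it has an infinite place). [folklore] -/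
private theorem not_isTotallyReal_of_isTotallyComplex (K : Type*) [Field K] [NumberField K]
    [IsTotallyComplex K] : ¬ IsTotallyReal K := fun h => by
  obtain ⟨w⟩ : Nonempty (InfinitePlace K) := inferInstance
  exact InfinitePlace.not_isReal_iff_isComplex.2 (IsTotallyComplex.isComplex w) (h.isReal w)

/-- **If `End⁰(A)` is a field `E` and `A` has no factor of type IV, then `E` is totally real**: every `x ∈ E` is
central, so it is killed by a non-zero rational polynomial with only real complex roots, and `φ(x)` is such a root for
every embedding `φ : E → ℂ`; hence every `φ` is real. (Types I–III: the centre is totally real.)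
[cite: MoonenZarhin1999LowDim, §1] [cite: Shimura1998, §5.1 Proposition 5 (p. 36)] -/
theorem isTotallyReal_endField_of_hasNoTypeIVFactor (hF : IsField A.endAlgebra) (h : HasNoTypeIVFactor A) :
    IsTotallyReal (EndField A hF) := by
  refine Literature.NumberTheory.NumberFields.isTotallyReal_of_forall_isReal fun φ => ?_
  rw [ComplexEmbedding.isReal_iff]
  ext x
  rw [ComplexEmbedding.conjugate_coe_eq, Complex.conj_eq_iff_im]
  let z : A.endAlgebra := EndField.toEndAlgebra hF x
  have hz : z ∈ Subalgebra.center ℚ A.endAlgebra := Subalgebra.mem_center_iff.2 fun b => hF.mul_comm b z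
  obtain ⟨f, -, hfz, hroots⟩ := h z hz
  let ψ : A.endAlgebra →ₐ[ℚ] ℂ := φ.toRatAlgHom.comp (EndField.toEndAlgebra hF).symm.toRingHom.toRatAlgHom
  have hψ : ψ z = φ x := rfl
  refine hroots _ ?_
  rw [← hψ, Polynomial.aeval_algHom_apply, hfz, map_zero]

/-- **`End⁰(A)` a field: NO FACTOR OF TYPE IV ⟺ `End⁰(A)` IS TOTALLY REAL** (the converse direction is the tree's
`hasNoTypeIVFactor_of_isTotallyReal`). [cite: MoonenZarhin1999LowDim, §1] [cite: Shimura1998, §5.1 Proposition 5 (p. 36)] -/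
theorem hasNoTypeIVFactor_iff_isTotallyReal_endField (hF : IsField A.endAlgebra) :
    HasNoTypeIVFactor A ↔ IsTotallyReal (EndField A hF) :=
  ⟨isTotallyReal_endField_of_hasNoTypeIVFactor hF, fun h => by
    haveI := h
    exact hasNoTypeIVFactor_of_isTotallyReal A hF⟩

/-- If `End⁰(A)` is a totally complex field then `A` has a factor of type IV. [cite: MoonenZarhin1999LowDim, §1] -/
theorem not_hasNoTypeIVFactor_of_isTotallyComplex_endField (hF : IsField A.endAlgebra)
    (hc : IsTotallyComplex (EndField A hF)) : ¬ HasNoTypeIVFactor A := fun h => by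
  haveI := hc
  exact not_isTotallyReal_of_isTotallyComplex (EndField A hF) (isTotallyReal_endField_of_hasNoTypeIVFactor hF h)

/-- **If `End⁰(A)` is a CM field then `A` has a factor of type IV** (type 4: the centre is a CM field).
[cite: MoonenZarhin1999LowDim, §1] [cite: MumfordAV1970, §21 Thm. 2 (type IV)] -/
theorem not_hasNoTypeIVFactor_of_isCMField_endField (hF : IsField A.endAlgebra)
    (hCM : IsCMField (EndField A hF)) : ¬ HasNoTypeIVFactor A := by
  haveI := hCM
  exact not_hasNoTypeIVFactor_of_isTotallyComplex_endField hF inferInstance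

/-- **`End⁰(A)` a field: A FACTOR OF TYPE IV ⟺ `End⁰(A)` IS A CM FIELD.** `A` is then simple (tree
`isSimple_of_isField_endAlgebra`) of positive dimension, and `End⁰` of a simple complex abelian variety, when a field,
is totally real or CM (Shimura §5.1 Prop. 5, tree `isTotallyReal_or_isCMField_endField_of_isSimple`).
[cite: Shimura1998, §5.1 Proposition 5 (p. 36)] [cite: Deligne1982HodgeCycles, I Prop. 5.1] [cite: MoonenZarhin1999LowDim, §1] -/
theorem not_hasNoTypeIVFactor_iff_isCMField_endField (hF : IsField A.endAlgebra) :
    ¬ HasNoTypeIVFactor A ↔ IsCMField (EndField A hF) := by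
  rw [hasNoTypeIVFactor_iff_isTotallyReal_endField hF]
  refine ⟨fun h => (isTotallyReal_or_isCMField_endField_of_isSimple A
      (AbelianVariety.isSimple_of_isField_endAlgebra hF) (AbelianVariety.dim_pos_of_isField_endAlgebra hF)
      hF).resolve_left h, fun hCM => ?_⟩
  haveI := hCM
  exact not_isTotallyReal_of_isTotallyComplex _

/-- … equivalently `HasNoTypeIVFactor A ↔ ¬ IsCMField (End⁰ A)`. [cite: Shimura1998, §5.1 Proposition 5 (p. 36)]
[cite: MoonenZarhin1999LowDim, §1] -/
theorem hasNoTypeIVFactor_iff_not_isCMField_endField (hF : IsField A.endAlgebra) :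
    HasNoTypeIVFactor A ↔ ¬ IsCMField (EndField A hF) := by
  rw [← not_hasNoTypeIVFactor_iff_isCMField_endField hF, not_not]

/-! ### §2 Milne's vocabulary: simple isogeny factors -/

/-- **A simple isogeny factor of an abelian variety without factor of type IV has none** (`A ∼ B × C`, g29-#2
`HasNoTypeIVFactor.of_isIsogenous_prod_left`). [cite: MoonenZarhin1999LowDim, §1] [cite: MumfordAV1970, §19 Cor. 1–2 (pp. 173–174)] -/
theorem HasNoTypeIVFactor.of_isSimpleIsogenyFactor (hA : HasNoTypeIVFactor A) (h : IsSimpleIsogenyFactor B A) :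
    HasNoTypeIVFactor B := by
  obtain ⟨-, -, C, hC⟩ := h
  exact hA.of_isIsogenous_prod_left hC

/-- … so its centre `Z(End⁰ B)` is totally real (types I–III). [cite: MoonenZarhin1999LowDim, §1]
[cite: Shimura1998, §5.1 Proposition 5 (p. 36)] -/
theorem isTotallyReal_centerField_of_isSimpleIsogenyFactor (hA : HasNoTypeIVFactor A)
    (h : IsSimpleIsogenyFactor B A) : IsTotallyReal (CenterField B h.1 h.2.1) :=
  (hasNoTypeIVFactor_iff_isTotallyReal_centerField h.1 h.2.1).1 (hA.of_isSimpleIsogenyFactor h)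

/-- A simple isogeny factor with CM centre is a factor of type IV. [cite: MoonenZarhin1999LowDim, §1]
[cite: Shimura1998, §5.1 Proposition 5 (p. 36)] -/
theorem not_hasNoTypeIVFactor_of_isSimpleIsogenyFactor_of_isCMField_centerField (h : IsSimpleIsogenyFactor B A)
    (hCM : IsCMField (CenterField B h.1 h.2.1)) : ¬ HasNoTypeIVFactor A := fun hA =>
  (not_hasNoTypeIVFactor_iff_isCMField_centerField h.1 h.2.1).2 hCM (hA.of_isSimpleIsogenyFactor h)

/-- **«`A` HAS NO SIMPLE FACTOR OF TYPE IV» IN MILNE'S VOCABULARY**: `HasNoTypeIVFactor A` iff every simple isogeny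
factor `B` of `A` (Milne 1986 §12: `B` simple, `B ≠ 0`, `A ∼ B × C`) has `HasNoTypeIVFactor B` — no dimension
hypothesis (`dim A = 0`: both sides hold). [cite: MoonenZarhin1999LowDim, §1] [cite: Milne1986AbelianVarieties, §12 p. 122]
[cite: MumfordAV1970, §19 Thm. 1 and Cor. 1–2 (pp. 173–174)] -/
theorem hasNoTypeIVFactor_iff_forall_isSimpleIsogenyFactor :
    HasNoTypeIVFactor A ↔ ∀ B : AbelianVariety ℂ, IsSimpleIsogenyFactor B A → HasNoTypeIVFactor B := by
  refine ⟨fun hA B h => hA.of_isSimpleIsogenyFactor h, fun h => ?_⟩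
  rcases Nat.eq_zero_or_pos A.dim with hA0 | hA0
  · haveI := AbelianVariety.subsingleton_endAlgebra_of_dim_eq_zero hA0
    intro z _
    refine ⟨Polynomial.X, Polynomial.X_ne_zero, Subsingleton.elim _ _, fun x hx => ?_⟩
    rw [Polynomial.aeval_X] at hx
    rw [hx, Complex.zero_im]
  · exact (hasNoTypeIVFactor_iff_forall_isSimple_hom_ne_zero hA0).2 fun B hB hB0 f hf =>
      (hasNoTypeIVFactor_iff_isTotallyReal_centerField hB hB0).1
        (h B (isSimpleIsogenyFactor_of_hom_ne_zero hB hB0 f hf))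

/-- … with the type read on the centres: every simple isogeny factor has totally real centre `Z(End⁰ B)`.
[cite: MoonenZarhin1999LowDim, §1] [cite: Shimura1998, §5.1 Proposition 5 (p. 36)] [cite: Milne1986AbelianVarieties, §12 p. 122] -/
theorem hasNoTypeIVFactor_iff_forall_isSimpleIsogenyFactor_isTotallyReal_centerField :
    HasNoTypeIVFactor A ↔
      ∀ (B : AbelianVariety ℂ) (h : IsSimpleIsogenyFactor B A), IsTotallyReal (CenterField B h.1 h.2.1) := by
  rw [hasNoTypeIVFactor_iff_forall_isSimpleIsogenyFactor]
  exact forall₂_congr fun B h => hasNoTypeIVFactor_iff_isTotallyReal_centerField h.1 h.2.1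

/-- **`A` has a factor of type IV iff some simple isogeny factor of `A` has CM centre.** [cite: MoonenZarhin1999LowDim, §1]
[cite: Shimura1998, §5.1 Proposition 5 (p. 36)] [cite: Milne1986AbelianVarieties, §12 p. 122] -/
theorem not_hasNoTypeIVFactor_iff_exists_isSimpleIsogenyFactor_isCMField_centerField :
    ¬ HasNoTypeIVFactor A ↔
      ∃ (B : AbelianVariety ℂ) (h : IsSimpleIsogenyFactor B A), IsCMField (CenterField B h.1 h.2.1) := by
  rw [hasNoTypeIVFactor_iff_forall_isSimpleIsogenyFactor]
  push Not
  exact exists_congr fun B =>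
    ⟨fun ⟨h, hB⟩ => ⟨h, (not_hasNoTypeIVFactor_iff_isCMField_centerField h.1 h.2.1).1 hB⟩,
      fun ⟨h, hCM⟩ => ⟨h, (not_hasNoTypeIVFactor_iff_isCMField_centerField h.1 h.2.1).2 hCM⟩⟩

/-! ### §3 Abelian varieties of CM-type have all their simple factors of type IV -/

/-- **A SIMPLE COMPLEX ABELIAN VARIETY OF CM-TYPE IS OF TYPE IV**: `End⁰(B)` is a field of degree `2 dim B`
(Shimura §5.1 Props. 4, 6; tree `IsOfCMType.isOfCMTypeSimple`) which is totally complex (Shimura §5.2 «`K` must be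
totally imaginary»; tree `endField_isTotallyComplex_of_isSimple`), so not totally real, and §1 applies.
[cite: Shimura1998, §5.1 Propositions 4–6 and §5.2 (pp. 36–37)] [cite: Milne1999, §2 p. 54] [cite: MoonenZarhin1999LowDim, §1] -/
theorem not_hasNoTypeIVFactor_of_isSimple_of_isOfCMType (hB : AbelianVariety.IsSimple B) (hB0 : 0 < B.dim)
    (hCM : IsOfCMType B) : ¬ HasNoTypeIVFactor B :=
  not_hasNoTypeIVFactor_of_isTotallyComplex_endField _ (endField_isTotallyComplex_of_isSimple hB hB0 hCM)

/-- The same from Milne's clause `IsOfCMTypeSimple B` (`End⁰(B)` a field of degree `2 dim B`). [cite: Milne1999, §2 p. 54]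
[cite: Shimura1998, §5.2 (pp. 36–37)] -/
theorem not_hasNoTypeIVFactor_of_isOfCMTypeSimple (hB : AbelianVariety.IsSimple B) (hB0 : 0 < B.dim)
    (h : IsOfCMTypeSimple B) : ¬ HasNoTypeIVFactor B :=
  not_hasNoTypeIVFactor_of_isSimple_of_isOfCMType hB hB0 h.isOfCMType

/-- **The centre of `End⁰(B)`, `B` simple of CM-type, is a CM field** (type IV read on the centre, g29-#3 / tree
`not_hasNoTypeIVFactor_iff_isCMField_centerField`). [cite: Shimura1998, §5.1 Proposition 5 and §5.2 (pp. 36–37)]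
[cite: Milne1999, §2 p. 54] -/
theorem isCMField_centerField_of_isOfCMType (hB : AbelianVariety.IsSimple B) (hB0 : 0 < B.dim)
    (hCM : IsOfCMType B) : IsCMField (CenterField B hB hB0) :=
  (not_hasNoTypeIVFactor_iff_isCMField_centerField hB hB0).1
    (not_hasNoTypeIVFactor_of_isSimple_of_isOfCMType hB hB0 hCM)

/-- The zero abelian variety has no factor of type IV (it has no simple isogeny factor at all; Moonen–Zarhin §1 states
the notion for `X ≠ 0`). [cite: MoonenZarhin1999LowDim, §1] [cite: MumfordAV1970, §19 Cor. 1 (p. 173)] -/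
theorem hasNoTypeIVFactor_of_dim_eq_zero (hA : A.dim = 0) : HasNoTypeIVFactor A :=
  hasNoTypeIVFactor_iff_forall_isSimpleIsogenyFactor.2 fun _ h => absurd hA h.dim_pos_right.ne'

/-- **A simple isogeny factor of an abelian variety of CM-type is of type IV** (it is of CM-type, Milne 1999 p. 54;
tree `isOfCMTypeSimple_of_isSimpleIsogenyFactor`). [cite: Milne1999, §2 p. 54] [cite: Shimura1998, §5.2 (pp. 36–37)] -/
theorem not_hasNoTypeIVFactor_of_isSimpleIsogenyFactor_of_isOfCMType (hA : IsOfCMType A)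
    (h : IsSimpleIsogenyFactor B A) : ¬ HasNoTypeIVFactor B :=
  not_hasNoTypeIVFactor_of_isOfCMTypeSimple h.1 h.2.1 (isOfCMTypeSimple_of_isSimpleIsogenyFactor hA h)

/-- … and its centre is a CM field. [cite: Milne1999, §2 p. 54] [cite: Shimura1998, §5.1 Proposition 5 (p. 36)] -/
theorem isCMField_centerField_of_isSimpleIsogenyFactor_of_isOfCMType (hA : IsOfCMType A)
    (h : IsSimpleIsogenyFactor B A) : IsCMField (CenterField B h.1 h.2.1) :=
  isCMField_centerField_of_isOfCMType h.1 h.2.1 (isOfCMTypeSimple_of_isSimpleIsogenyFactor hA h).isOfCMType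

/-- **A NON-ZERO COMPLEX ABELIAN VARIETY OF CM-TYPE HAS A FACTOR OF TYPE IV** (indeed all its simple factors are of
type IV): a simple `B ≠ 0` with `Hom(B, A) ∋ f ≠ 0` (§0) is of CM-type (tree `IsOfCMType.of_ne_zero_hom_from_isSimple`)
hence of type IV, and it is a factor of `A` (g29-#5 `HasNoTypeIVFactor.of_hom_ne_zero_of_isSimple`).
[cite: Milne1999, §2 p. 54] [cite: Shimura1998, §5.2 (pp. 36–37)] [cite: MoonenZarhin1999LowDim, §1] -/
theorem not_hasNoTypeIVFactor_of_isOfCMType (hCM : IsOfCMType A) (hA0 : 0 < A.dim) : ¬ HasNoTypeIVFactor A :=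
  fun hA => by
  obtain ⟨B, hB, hB0, f, hf⟩ := AbelianVariety.exists_isSimple_hom_ne_zero hA0
  exact not_hasNoTypeIVFactor_of_isSimple_of_isOfCMType hB hB0 (hCM.of_ne_zero_hom_from_isSimple hB f hf)
    (hA.of_hom_ne_zero_of_isSimple hB f hf)

/-- A non-zero abelian variety without factor of type IV is not of CM-type. [cite: MoonenZarhin1999LowDim, §1]
[cite: Milne1999, §2 p. 54] -/
theorem HasNoTypeIVFactor.not_isOfCMType (hA : HasNoTypeIVFactor A) (hA0 : 0 < A.dim) : ¬ IsOfCMType A :=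
  fun hCM => not_hasNoTypeIVFactor_of_isOfCMType hCM hA0 hA

/-- An abelian variety without factor of type IV which is of CM-type is zero. [cite: MoonenZarhin1999LowDim, §1]
[cite: Milne1999, §2 p. 54] -/
theorem HasNoTypeIVFactor.dim_eq_zero_of_isOfCMType (hA : HasNoTypeIVFactor A) (hCM : IsOfCMType A) :
    A.dim = 0 := by
  by_contra h0
  exact not_hasNoTypeIVFactor_of_isOfCMType hCM (by omega) hA

/-- `HasNoTypeIVFactor A ∧ IsOfCMType A ↔ dim A = 0`. [cite: MoonenZarhin1999LowDim, §1] [cite: Milne1999, §2 p. 54] -/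
theorem hasNoTypeIVFactor_and_isOfCMType_iff_dim_eq_zero :
    HasNoTypeIVFactor A ∧ IsOfCMType A ↔ A.dim = 0 :=
  ⟨fun h => h.1.dim_eq_zero_of_isOfCMType h.2,
    fun h => ⟨hasNoTypeIVFactor_of_dim_eq_zero h, isOfCMType_of_dim_eq_zero h⟩⟩

/-! ### §4 `Hom(A, C) = 0 = Hom(C, A)` for `A` without factor of type IV and `C` of CM-type -/

/-- **`Hom(A, C) = 0` FOR `A` WITHOUT FACTOR OF TYPE IV AND `C` OF CM-TYPE**: the image of `f : A → C` is a quotient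
of `A` (no factor of type IV, g29-#5 `image_of_source`) and an abelian subvariety of `C` (of CM-type, tree
`IsOfCMType.image_of_target`), hence zero (§3), so `f = 0` (`dim_image_pos`). In print: `A` and `C` have no simple
isogeny factor in common. [cite: MumfordAV1970, §19 Thm. 1 and Cor. 1–2 (pp. 173–174)] [cite: Milne1999, §2 p. 54]
[cite: MoonenZarhin1999LowDim, §1] -/
theorem hom_eq_zero_of_hasNoTypeIVFactor_of_isOfCMType (hA : HasNoTypeIVFactor A) (hC : IsOfCMType C)
    (f : A ⟶ C) : f = 0 := by
  by_contra hf
  exact not_hasNoTypeIVFactor_of_isOfCMType (hC.image_of_target f) (AbelianVariety.dim_image_pos f hf)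
    (hA.image_of_source f)

/-- **`Hom(C, A) = 0` for `C` of CM-type and `A` without factor of type IV.**
[cite: MumfordAV1970, §19 Thm. 1 and Cor. 1–2 (pp. 173–174)] [cite: Milne1999, §2 p. 54] [cite: MoonenZarhin1999LowDim, §1] -/
theorem hom_eq_zero_of_isOfCMType_of_hasNoTypeIVFactor (hC : IsOfCMType C) (hA : HasNoTypeIVFactor A)
    (f : C ⟶ A) : f = 0 := by
  by_contra hf
  exact not_hasNoTypeIVFactor_of_isOfCMType (hC.image_of_source f) (AbelianVariety.dim_image_pos f hf)
    (hA.image_of_target f)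

/-- `Hom(A, C)` is trivial for `A` without factor of type IV and `C` of CM-type. [cite: MumfordAV1970, §19 Cor. 1–2 (pp. 173–174)] -/
theorem subsingleton_hom_of_hasNoTypeIVFactor_of_isOfCMType (hA : HasNoTypeIVFactor A) (hC : IsOfCMType C) :
    Subsingleton (A ⟶ C) :=
  ⟨fun f g => by
    rw [hom_eq_zero_of_hasNoTypeIVFactor_of_isOfCMType hA hC f,
      hom_eq_zero_of_hasNoTypeIVFactor_of_isOfCMType hA hC g]⟩

/-- `Hom(C, A)` is trivial for `C` of CM-type and `A` without factor of type IV. [cite: MumfordAV1970, §19 Cor. 1–2 (pp. 173–174)] -/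
theorem subsingleton_hom_of_isOfCMType_of_hasNoTypeIVFactor (hC : IsOfCMType C) (hA : HasNoTypeIVFactor A) :
    Subsingleton (C ⟶ A) :=
  ⟨fun f g => by
    rw [hom_eq_zero_of_isOfCMType_of_hasNoTypeIVFactor hC hA f,
      hom_eq_zero_of_isOfCMType_of_hasNoTypeIVFactor hC hA g]⟩

/-- **No common simple isogeny factor**: a simple isogeny factor of an abelian variety without factor of type IV is not
a simple isogeny factor of an abelian variety of CM-type. [cite: MumfordAV1970, §19 Cor. 1–2 (pp. 173–174)]
[cite: Milne1999, §2 p. 54] [cite: MoonenZarhin1999LowDim, §1] -/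
theorem not_isSimpleIsogenyFactor_of_hasNoTypeIVFactor_of_isOfCMType (hA : HasNoTypeIVFactor A)
    (hC : IsOfCMType C) (hBA : IsSimpleIsogenyFactor B A) : ¬ IsSimpleIsogenyFactor B C := fun hBC =>
  not_hasNoTypeIVFactor_of_isSimpleIsogenyFactor_of_isOfCMType hC hBC (hA.of_isSimpleIsogenyFactor hBA)

end Literature.AlgebraicGeometry.HodgeTheory
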